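import Literature.NumberTheory.EllipticCurves.PlusMinusPAdicLFunctionProofs
import HarnessLib

/-!
# Crux `ResidualThetaMainConjectureAtTwo` (stmt-BirchSwinnertonDyer-20787), line `birth` v5 — toward stub (R1c)
# `stub_pollackPairKAtTwo`: the THREE-TERM RELATION of abstract theta sums built from a `ℤ`-periodic,
# Hecke-null symbol function (Mazur–Tate–Teitelbaum §I.10 with the symbol abstracted) — part 1 (abstract)

Cell `bsd-wall`, seat `bsd-wall-rtt-p2` (LEAD PROVER, line mode, g2). THEOREMS ONLY (no `def`, no named fact, no
`sorry`); `--supports stmt-BirchSwinnertonDyer-20787`; closes nothing by itself.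

WHY. Stub (R1c) asks for a Pollack pair of the CM partner `g` over `𝓞 = 𝓞_{ℚ₂(ι K_g)}` at `p = 2`
(`IsPollackPairK g ι Ω L⁺ L⁻`). Pollack's construction (tree: `pollack_exists_plusMinusPAdicLFunction_holds`, RATIONAL
newforms, `p` odd; `Sprung2017.exists_isSprungPair_two`, rational, `p = 2`) starts from the three-term (distribution)
relation of the Mazur–Tate elements, `π_{n+2/n+1} θ_{n+2} = a_p θ_{n+1} − ν θ_n`, i.e. for `a_p = 0`:
`ω_{n+1} ∣ θ_{n+2} + Φ_{p^{n+1}}(1+T)·θ_n`. The tree proves it for `mazurTateElement f p n ∈ ℚ[T]` of a RATIONAL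
newform (`cyclotomicOmega_dvd_mazurTateElement_add`). This file proves it for the `K_g`-valued elements
`mazurTateElementK g Ω p n` of ANY newform `g ∈ S₂(Γ₀(M))` with `p ∤ M`, `a_p(g) = 0` and ANY plus period `Ω`
(`IsPlusPeriod g Ω`), by first isolating the ABSTRACT statement: for every function `φ : ℚ → F` into a commutative
ring which is `ℤ`-PERIODIC and HECKE-NULL at `p` (`∑_{j<p} φ((r+j)/p) = −φ(pr)`), the theta sums
`Θ_m(φ) = ∑_η ∑_{s mod p^m} φ([η γ^s/p^{m+e₀}])(1+T)^s ∈ F[T]` satisfy `ω_{n+1} ∣ Θ_{n+2} + Φ_{p^{n+1}}(1+T) Θ_n`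
(`cyclotomicOmega_dvd_thetaSum_add`; the proof is the tree's, fibre by fibre, with the symbol function abstracted),
and then instantiating `φ = plusSymbolK g Ω` (`[r]⁺_{g,Ω} = plusSymbol g r / Ω ∈ K_g`): Hecke-null by the tree
theorem `cuspCoeff_mul_plusSymbol` (`a_p(g)·[r]⁺ = ∑_j [(r+j)/p]⁺ + [pr]⁺`, any newform, `p ∤ M`) with `a_p(g) = 0`,
periodic by `modularSymbol_add_intCast_holds` — `cyclotomicOmega_dvd_mazurTateElementK_add`. BSD is not proved by any
of this; (R1c) further needs the `𝓞`-adic limit and Rohrlich's non-vanishing (both in the tree for the rational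
case / for newforms), see `Lines/birth.md`.

References: B. Mazur, J. Tate, J. Teitelbaum, Invent. Math. 84 (1986) §I.4 (4.2), §I.10 (10.2)
[MazurTateTeitelbaum1986Invent]; R. Pollack, Duke Math. J. 118 (2003) §6.5 [Pollack2003]; R. Pollack, T. Weston, Duke
Math. J. 156 (2011) §2.1–2.2 [PollackWeston2011MT].
-/

set_option linter.dupNamespace false
set_option autoImplicit false

noncomputable section

open scoped Classical MatrixGroups ModularForm

open CongruenceSubgroup Polynomial Literature.NumberTheory.EllipticCurves
  Literature.NumberTheory.EllipticCurves.ModularForms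

namespace Summit.BirchSwinnertonDyer.BirchSwinnertonDyer.Theorems.ResidualThetaLayer

/-! ## §1. Reindexing finite sums -/

section Reindex

variable {M : Type*} [AddCommMonoid M]

/-- Reindexing a sum over `ℤ/m` by the representatives `0 ≤ a.val < m`. [folklore] -/
private theorem sum_univ_zmod_val' (m : ℕ) [NeZero m] (g : ℕ → M) :
    ∑ a : ZMod m, g a.val = ∑ k ∈ Finset.range m, g k := by
  refine Finset.sum_bij (fun a _ ↦ a.val) (fun a _ ↦ Finset.mem_range.mpr (ZMod.val_lt a))
    (fun a _ b _ h ↦ ZMod.val_injective m h) (fun k hk ↦ ?_) (fun _ _ ↦ rfl)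
  exact ⟨(k : ZMod m), Finset.mem_univ _, ZMod.val_cast_of_lt (Finset.mem_range.mp hk)⟩

/-- `∑_{k < a·b} g(k) = ∑_{j < a} ∑_{t < b} g(t + b·j)` (Euclidean division by `b`). [folklore] -/
private theorem sum_range_mul_eq_sum_sum' (a b : ℕ) (g : ℕ → M) :
    ∑ k ∈ Finset.range (a * b), g k =
      ∑ j ∈ Finset.range a, ∑ t ∈ Finset.range b, g (t + b * j) := by
  rw [← Fin.sum_univ_eq_sum_range g (a * b),
    ← finProdFinEquiv.sum_comp (fun x : Fin (a * b) ↦ g x), Fintype.sum_prod_type,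
    ← Fin.sum_univ_eq_sum_range (fun j ↦ ∑ t ∈ Finset.range b, g (t + b * j)) a]
  refine Finset.sum_congr rfl fun j _ ↦ ?_
  rw [← Fin.sum_univ_eq_sum_range (fun t ↦ g (t + b * j)) b]
  refine Finset.sum_congr rfl fun t _ ↦ ?_
  rw [finProdFinEquiv_apply_val]

end Reindex

/-! ## §2. The Hecke relation at `p` with `a_p = 0` along the fibres of `ℤ/p^{L+1} → ℤ/p^L` -/

section Fiber

variable {F : Type*} [CommRing F] (φ : ℚ → F) {p : ℕ} [Fact p.Prime]

/-- **The fibre sum at `a_p = 0`**: for `a mod p^L`, summing `[b/p^{L+1}]⁺_f` over the `p` lifts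
`b` of `a` to `ℤ/p^{L+1}` gives `−[p · a/p^L]⁺_f = −[a/p^{L-1}]⁺_f`: the lifts are `a + p^L j`,
`j < p` (`filter_castHom_eq_image`), `(a + p^L j)/p^{L+1} = (a/p^L + j)/p`, and the Hecke relation
with `a_p = 0` (`sum_range_ratPlusSymbol_div_eq_neg`) (Mazur–Tate–Teitelbaum 1986, §I.10 (10.2):
the distribution relation `π_{L+1/L} θ_{L+1} = a_p θ_L − ν θ_{L-1}`).
[cite: MazurTateTeitelbaum1986Invent, §I.10 Prop. (10.2)] -/
theorem sum_fiber_eq_neg_of_heckeNull (hH : ∀ r : ℚ, ∑ j ∈ Finset.range p, φ ((r + j) / p) = -φ (p * r)) {L L' : ℕ} (hL : L' = L + 1)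
    (hdvd : p ^ L ∣ p ^ L') (a : ZMod (p ^ L)) :
    ∑ b ∈ Finset.univ.filter (fun b : ZMod (p ^ L') ↦ ZMod.castHom hdvd (ZMod (p ^ L)) b = a),
        φ ((b.val : ℚ) / (p : ℚ) ^ L') =
      -φ (p * ((a.val : ℚ) / (p : ℚ) ^ L)) := by
  classical
  subst hL
  have hp : p.Prime := Fact.out
  haveI : NeZero p := ⟨hp.ne_zero⟩
  have hp0 : (p : ℚ) ≠ 0 := Nat.cast_ne_zero.mpr hp.ne_zero
  have hinj : Function.Injective
      (fun j : Fin p ↦ ((a.val + p ^ L * (j : ℕ) : ℕ) : ZMod (p ^ (L + 1)))) := by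
    intro j j' h
    have hv := congr_arg ZMod.val h
    simp only [val_classLift] at hv
    exact Fin.ext (Nat.eq_of_mul_eq_mul_left (pow_pos hp.pos L) (by omega))
  rw [filter_castHom_eq_image, Finset.sum_image fun j _ j' _ h ↦ hinj h]
  set x : ℚ := (a.val : ℚ) / (p : ℚ) ^ L with hx
  have hA : ∀ j : Fin p,
      ((a.val + p ^ L * (j : ℕ) : ℕ) : ℚ) / (p : ℚ) ^ (L + 1) = (x + j) / p := by
    intro j
    rw [hx]
    push_cast
    field_simp
    ring
  have hHx := hH x
  rw [← Fin.sum_univ_eq_sum_range (fun j ↦ φ ((x + j) / p)) p] at hHx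
  rw [← hHx]
  refine Finset.sum_congr rfl fun j _ ↦ ?_
  rw [val_classLift, hA]

/-- The fibre of `ℤ/p^{L+1} → ℤ/p^L` over any class has exactly `p` elements. [folklore] -/
private theorem card_filter_castHom_eq' {L L' : ℕ} (hL : L' = L + 1) (hdvd : p ^ L ∣ p ^ L')
    (a : ZMod (p ^ L)) :
    (Finset.univ.filter (fun b : ZMod (p ^ L') ↦ ZMod.castHom hdvd (ZMod (p ^ L)) b = a)).card
      = p := by
  classical
  subst hL
  have hp : p.Prime := Fact.out
  have hinj : Function.Injective
      (fun j : Fin p ↦ ((a.val + p ^ L * (j : ℕ) : ℕ) : ZMod (p ^ (L + 1)))) := by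
    intro j j' h
    have hv := congr_arg ZMod.val h
    simp only [val_classLift] at hv
    exact Fin.ext (Nat.eq_of_mul_eq_mul_left (pow_pos hp.pos L) (by omega))
  rw [filter_castHom_eq_image, Finset.card_image_of_injective _ hinj, Finset.card_univ,
    Fintype.card_fin]

/-- **An orbit of `δ = γ^{p^{m}}` is a fibre.** Let `b₀` be a unit of `ℤ/p^{L+1}` and `δ` an
element of order `p` reducing to `1` modulo `p^L`; then `{b₀ δ^j : j < p}` is exactly the fibre of
`ℤ/p^{L+1} → ℤ/p^L` over `b₀ mod p^L` (both have `p` elements). [folklore] -/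
private theorem image_mul_pow_eq_filter' {L L' : ℕ} (hL : L' = L + 1) (hdvd : p ^ L ∣ p ^ L')
    {b₀ δ : ZMod (p ^ L')} (hb₀ : IsUnit b₀) (hδ : orderOf δ = p)
    (hδ1 : ZMod.castHom hdvd (ZMod (p ^ L)) δ = 1) :
    Finset.univ.image (fun j : Fin p ↦ b₀ * δ ^ (j : ℕ)) =
      Finset.univ.filter (fun b : ZMod (p ^ L') ↦
        ZMod.castHom hdvd (ZMod (p ^ L)) b = ZMod.castHom hdvd (ZMod (p ^ L)) b₀) := by
  classical
  have hinj : Function.Injective (fun j : Fin p ↦ b₀ * δ ^ (j : ℕ)) := by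
    intro j j' h
    have h1 : δ ^ (j : ℕ) = δ ^ (j' : ℕ) := hb₀.mul_right_inj.mp h
    have h2 := pow_injOn_Iio_orderOf (x := δ) (by rw [hδ]; exact j.2) (by rw [hδ]; exact j'.2) h1
    exact Fin.ext h2
  refine Finset.eq_of_subset_of_card_le (fun b hb ↦ ?_) ?_
  · obtain ⟨j, -, rfl⟩ := Finset.mem_image.mp hb
    simp only [Finset.mem_filter, Finset.mem_univ, true_and, map_mul, map_pow, hδ1, one_pow,
      mul_one]
  · rw [card_filter_castHom_eq' hL hdvd, Finset.card_image_of_injective _ hinj, Finset.card_univ,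
      Fintype.card_fin]

/-- **Orbit form of the fibre sum**: with `b₀`, `δ` as in `image_mul_pow_eq_filter`,
`∑_{j<p} [b₀δ^j / p^{L+1}]⁺_f = −[p · (b₀ mod p^L)/p^L]⁺_f` (`a_p = 0`). [folklore] -/
theorem sum_range_orbit_eq_neg_of_heckeNull (hH : ∀ r : ℚ, ∑ j ∈ Finset.range p, φ ((r + j) / p) = -φ (p * r)) {L L' : ℕ} (hL : L' = L + 1)
    (hdvd : p ^ L ∣ p ^ L') {b₀ δ : ZMod (p ^ L')} (hb₀ : IsUnit b₀) (hδ : orderOf δ = p)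
    (hδ1 : ZMod.castHom hdvd (ZMod (p ^ L)) δ = 1) :
    ∑ j ∈ Finset.range p, φ (((b₀ * δ ^ j).val : ℚ) / (p : ℚ) ^ L') =
      -φ
        (p * (((ZMod.castHom hdvd (ZMod (p ^ L)) b₀).val : ℚ) / (p : ℚ) ^ L)) := by
  classical
  have hinj : Function.Injective (fun j : Fin p ↦ b₀ * δ ^ (j : ℕ)) := by
    intro j j' h
    have h1 : δ ^ (j : ℕ) = δ ^ (j' : ℕ) := hb₀.mul_right_inj.mp h
    have h2 := pow_injOn_Iio_orderOf (x := δ) (by rw [hδ]; exact j.2) (by rw [hδ]; exact j'.2) h1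
    exact Fin.ext h2
  rw [← sum_fiber_eq_neg_of_heckeNull φ hH hL hdvd, ← image_mul_pow_eq_filter' hL hdvd
    hb₀ hδ hδ1, Finset.sum_image fun j _ j' _ h ↦ hinj h,
    ← Fin.sum_univ_eq_sum_range (fun j ↦ φ (((b₀ * δ ^ j).val : ℚ) / (p : ℚ) ^ L')) p]

omit [CommRing F] in
/-- `φ(p · x/p^{S+1}) = φ((x mod p^S)/p^S)` for `x mod p^{S+1}` and a `ℤ`-periodic `φ`: `p·x/p^{S+1} = x/p^S` differs
from `(x mod p^S)/p^S` by an integer. [folklore] -/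
theorem apply_mul_div_pow_eq_of_periodic (hP : ∀ (r : ℚ) (k : ℤ), φ (r + k) = φ r) {S I : ℕ}
    (hI : I = S + 1) (hdvd : p ^ S ∣ p ^ I) (x : ZMod (p ^ I)) :
    φ (p * ((x.val : ℚ) / (p : ℚ) ^ I)) =
      φ (((ZMod.castHom hdvd (ZMod (p ^ S)) x).val : ℚ) / (p : ℚ) ^ S) := by
  subst hI
  have hp : p.Prime := Fact.out
  haveI : NeZero (p ^ S) := ⟨pow_ne_zero _ hp.ne_zero⟩
  have hp0 : (p : ℚ) ≠ 0 := Nat.cast_ne_zero.mpr hp.ne_zero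
  have hval : (ZMod.castHom hdvd (ZMod (p ^ S)) x).val = x.val % p ^ S := by
    rw [ZMod.castHom_apply, ZMod.cast_eq_val, ZMod.val_natCast]
  set q : ℕ := x.val / p ^ S with hq
  set r : ℕ := x.val % p ^ S with hr
  have hx : (x.val : ℚ) = (r : ℚ) + (p : ℚ) ^ S * (q : ℚ) := by
    rw [hr, hq]
    exact_mod_cast (Nat.mod_add_div x.val (p ^ S)).symm
  have heq : (p : ℚ) * ((x.val : ℚ) / (p : ℚ) ^ (S + 1)) =
      (r : ℚ) / (p : ℚ) ^ S + ((q : ℤ) : ℚ) := by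
    rw [hx, Int.cast_natCast, pow_succ]
    field_simp
  rw [heq, hP, hval]

end Fiber

/-! ## §3. The three-term relation `θ_{n+2} ≡ −Φ_{p^{n+1}}(1+T) · θ_n (mod ω_{n+1})` -/

section ThreeTerm

variable {F : Type*} [CommRing F] (φ : ℚ → F) {p : ℕ} [Fact p.Prime]

/-- The image of the abstract theta sum `Θ_m(φ) = ∑_η ∑_{s mod p^m} φ([η γ^s / p^{m+e₀}])·(1+T)^s` under a
ring homomorphism `π : F[T] → R`, with the inner sum over representatives `k < p^m`. [folklore] -/
theorem map_thetaSum_eq {R : Type*} [CommRing R] (π : F[X] →+* R) (m : ℕ)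
    [Fintype (rootsOfUnity (torsionOrder p) ℤ_[p])] :
    π (∑ w : rootsOfUnity (torsionOrder p) ℤ_[p], ∑ s : ZMod (p ^ (m)),
        C (φ (((PadicInt.toZModPow ((m) + cyclotomicExponent p) ((w : ℤ_[p]ˣ) : ℤ_[p]) *
              (cyclotomicGenerator p : ZMod (p ^ ((m) + cyclotomicExponent p))) ^ s.val).val : ℚ) /
          (p : ℚ) ^ ((m) + cyclotomicExponent p))) * (X + 1) ^ s.val) =
      ∑ w : rootsOfUnity (torsionOrder p) ℤ_[p], ∑ k ∈ Finset.range (p ^ m),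
        π (C (φ
          (((PadicInt.toZModPow (m + cyclotomicExponent p) ((w : ℤ_[p]ˣ) : ℤ_[p]) *
              (cyclotomicGenerator p : ZMod (p ^ (m + cyclotomicExponent p))) ^ k).val : ℚ) /
            (p : ℚ) ^ (m + cyclotomicExponent p)))) * π (X + 1) ^ k := by
  classical
  haveI : NeZero (p ^ m) := ⟨pow_ne_zero _ (Fact.out : p.Prime).ne_zero⟩
  rw [map_sum]
  refine Finset.sum_congr rfl fun w _ ↦ ?_
  rw [map_sum, ← sum_univ_zmod_val' (p ^ m) (fun k ↦ π (C (φ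
          (((PadicInt.toZModPow (m + cyclotomicExponent p) ((w : ℤ_[p]ˣ) : ℤ_[p]) *
              (cyclotomicGenerator p : ZMod (p ^ (m + cyclotomicExponent p))) ^ k).val : ℚ) /
            (p : ℚ) ^ (m + cyclotomicExponent p)))) * π (X + 1) ^ k)]
  refine Finset.sum_congr rfl fun s _ ↦ ?_
  rw [map_mul, map_pow]

/-- **The three-term relation of the Mazur–Tate elements at `a_p = 0`**
(Mazur–Tate 1987, (1.3); Mazur–Tate–Teitelbaum 1986, §I.10: `π_{n+2/n+1}(θ_{n+2}) =
a_p θ_{n+1} − ν_{n/n+1}(θ_n)`; with `a_p = 0` and `ν_{n/n+1} =` multiplication by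
`Φ_{p^{n+1}}(1+T) = ω_{n+1}/ω_n`): in `ℚ[T]`,
`ω_{n+1} ∣ θ_{n+2} + Φ_{p^{n+1}}(1+T) · θ_n`.
Proof: in `ℚ[T]/(ω_{n+1})`, where `u = 1 + T` has `u^{p^{n+1}} = 1`, write `k < p^{n+2}` as
`k = t + p^{n+1} j`; the classes `η γ^t · (γ^{p^{n+1}})^j`, `j < p`, form the fibre of
`ℤ/p^{n+2+e₀} → ℤ/p^{n+1+e₀}` over `η γ^t` (`γ^{p^{n+1}}` has order `p` modulo `p^{n+2+e₀}` and is
`≡ 1 (mod p^{n+1+e₀})`, `orderOf_cyclotomicGenerator`), so the Hecke relation with `a_p = 0` sums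
them to `−[η γ^t/p^{n+e₀}]⁺` (`sum_range_orbit_eq_neg_of_heckeNull`); then `t = t' + p^n k`
collects `∑_{k<p} u^{p^n k} = Φ_{p^{n+1}}(u)`. [cite: MazurTateTeitelbaum1986Invent, §I.10 Prop. (10.2)] -/
theorem cyclotomicOmega_dvd_thetaSum_add [Fintype (rootsOfUnity (torsionOrder p) ℤ_[p])]
    (hH : ∀ r : ℚ, ∑ j ∈ Finset.range p, φ ((r + j) / p) = -φ (p * r))
    (hP : ∀ (r : ℚ) (k : ℤ), φ (r + k) = φ r) (n : ℕ) :
    (cyclotomicOmega p (n + 1)).map (Int.castRingHom F) ∣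
      (∑ w : rootsOfUnity (torsionOrder p) ℤ_[p], ∑ s : ZMod (p ^ (n + 2)),
        C (φ (((PadicInt.toZModPow ((n + 2) + cyclotomicExponent p) ((w : ℤ_[p]ˣ) : ℤ_[p]) *
              (cyclotomicGenerator p : ZMod (p ^ ((n + 2) + cyclotomicExponent p))) ^ s.val).val : ℚ) /
          (p : ℚ) ^ ((n + 2) + cyclotomicExponent p))) * (X + 1) ^ s.val) +
        ((cyclotomic (p ^ (n + 1)) ℤ).comp (X + 1)).map (Int.castRingHom F) *
          (∑ w : rootsOfUnity (torsionOrder p) ℤ_[p], ∑ s : ZMod (p ^ (n)),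
        C (φ (((PadicInt.toZModPow ((n) + cyclotomicExponent p) ((w : ℤ_[p]ˣ) : ℤ_[p]) *
              (cyclotomicGenerator p : ZMod (p ^ ((n) + cyclotomicExponent p))) ^ s.val).val : ℚ) /
          (p : ℚ) ^ ((n) + cyclotomicExponent p))) * (X + 1) ^ s.val) := by
  classical
  have hp : p.Prime := Fact.out
  -- the three levels `S = n + e₀ < I = n + 1 + e₀ < B = n + 2 + e₀`
  have hIS : n + 1 + (cyclotomicExponent p) = (n + (cyclotomicExponent p)) + 1 := by omega
  have hBI : n + 2 + (cyclotomicExponent p) = (n + 1 + (cyclotomicExponent p)) + 1 := by omega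
  have hdvdIS : p ^ (n + (cyclotomicExponent p)) ∣ p ^ (n + 1 + (cyclotomicExponent p)) := pow_dvd_pow p (by omega)
  have hdvdBI : p ^ (n + 1 + (cyclotomicExponent p)) ∣ p ^ (n + 2 + (cyclotomicExponent p)) := pow_dvd_pow p (by omega)
  -- the quotient ring `ℚ[T]/(ω_{n+1})` and `u = 1 + T`
  set ωQ : F[X] := (cyclotomicOmega p (n + 1)).map (Int.castRingHom F) with hωQ
  rw [← AdjoinRoot.mk_eq_zero]
  set π : F[X] →+* AdjoinRoot ωQ := AdjoinRoot.mk ωQ with hπ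
  set u : AdjoinRoot ωQ := π (X + 1) with hu
  have hu1 : u ^ p ^ (n + 1) = 1 := by
    have hω : ((X : F[X]) + 1) ^ p ^ (n + 1) - 1 = ωQ := by
      rw [hωQ, cyclotomicOmega, Polynomial.map_sub, Polynomial.map_pow, Polynomial.map_add,
        Polynomial.map_X, Polynomial.map_one]
    have h0 : π (((X : F[X]) + 1) ^ p ^ (n + 1) - 1) = 0 := by
      rw [hω]
      exact AdjoinRoot.mk_self
    rw [map_sub, map_pow, map_one, sub_eq_zero] at h0
    rw [hu, h0]
  have hupow : ∀ a b : ℕ, u ^ (a + p ^ (n + 1) * b) = u ^ a := fun a b ↦ by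
    rw [pow_add, pow_mul, hu1, one_pow, mul_one]
  -- `γ` at the three levels
  have hγS : (cyclotomicGenerator p : ZMod (p ^ (n + (cyclotomicExponent p)))) ^ p ^ n = 1 := by
    rw [← orderOf_cyclotomicGenerator p n, pow_orderOf_eq_one]
  have hγI : (cyclotomicGenerator p : ZMod (p ^ (n + 1 + (cyclotomicExponent p)))) ^ p ^ (n + 1) = 1 := by
    rw [← orderOf_cyclotomicGenerator p (n + 1), pow_orderOf_eq_one]
  have hδord : orderOf ((cyclotomicGenerator p : ZMod (p ^ (n + 2 + (cyclotomicExponent p)))) ^ p ^ (n + 1)) = p := by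
    rw [orderOf_pow' _ (pow_ne_zero _ hp.ne_zero), orderOf_cyclotomicGenerator p (n + 2),
      Nat.gcd_eq_right (pow_dvd_pow p (by omega : n + 1 ≤ n + 2)), Nat.pow_div (by omega) hp.pos,
      show n + 2 - (n + 1) = 1 by omega, pow_one]
  have hδ1 : ZMod.castHom hdvdBI (ZMod (p ^ (n + 1 + (cyclotomicExponent p))))
      ((cyclotomicGenerator p : ZMod (p ^ (n + 2 + (cyclotomicExponent p)))) ^ p ^ (n + 1)) = 1 := by
    rw [map_pow, map_natCast, hγI]
  have hpdiv : ∀ v : ℚ, (p : ℚ) * (v / (p : ℚ) ^ (n + 1 + (cyclotomicExponent p))) = v / (p : ℚ) ^ (n + (cyclotomicExponent p)) := by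
    intro v
    have hp0 : (p : ℚ) ≠ 0 := Nat.cast_ne_zero.mpr hp.ne_zero
    rw [hIS, pow_succ]
    field_simp
  -- the common value `T = ∑_η ∑_{k<p} ∑_{t'<p^n} [η γ^{t'}/p^{n+e₀}]⁺ u^{t'} (u^{p^n})^k`
  set A : rootsOfUnity (torsionOrder p) ℤ_[p] → ℕ → F := fun w k ↦ φ
    (((PadicInt.toZModPow (n + (cyclotomicExponent p)) ((w : ℤ_[p]ˣ) : ℤ_[p]) *
        (cyclotomicGenerator p : ZMod (p ^ (n + (cyclotomicExponent p)))) ^ k).val : ℚ) / (p : ℚ) ^ (n + (cyclotomicExponent p))) with hA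
  set T : AdjoinRoot ωQ := ∑ w : rootsOfUnity (torsionOrder p) ℤ_[p], ∑ k ∈ Finset.range p,
    ∑ t ∈ Finset.range (p ^ n), π (C (A w t)) * (u ^ t * (u ^ p ^ n) ^ k) with hT
  -- `π(θ_n)` and `π(Φ_{p^{n+1}}(1+T))`
  have hθn : π (∑ w : rootsOfUnity (torsionOrder p) ℤ_[p], ∑ s : ZMod (p ^ (n)),
        C (φ (((PadicInt.toZModPow ((n) + cyclotomicExponent p) ((w : ℤ_[p]ˣ) : ℤ_[p]) *
              (cyclotomicGenerator p : ZMod (p ^ ((n) + cyclotomicExponent p))) ^ s.val).val : ℚ) /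
          (p : ℚ) ^ ((n) + cyclotomicExponent p))) * (X + 1) ^ s.val) =
      ∑ w : rootsOfUnity (torsionOrder p) ℤ_[p], ∑ t ∈ Finset.range (p ^ n),
        π (C (A w t)) * u ^ t := by
    rw [map_thetaSum_eq φ π n]
  have hξ : π (((cyclotomic (p ^ (n + 1)) ℤ).comp (X + 1)).map (Int.castRingHom F)) =
      ∑ k ∈ Finset.range p, (u ^ p ^ n) ^ k := by
    rw [cyclotomic_prime_pow_eq_geom_sum hp, Polynomial.sum_comp, Polynomial.map_sum, map_sum]
    refine Finset.sum_congr rfl fun k _ ↦ ?_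
    rw [pow_comp, pow_comp, X_comp, Polynomial.map_pow, Polynomial.map_pow, Polynomial.map_add,
      Polynomial.map_X, Polynomial.map_one, map_pow, map_pow]
  have hRHS : π (((cyclotomic (p ^ (n + 1)) ℤ).comp (X + 1)).map (Int.castRingHom F)) *
      π (∑ w : rootsOfUnity (torsionOrder p) ℤ_[p], ∑ s : ZMod (p ^ (n)),
        C (φ (((PadicInt.toZModPow ((n) + cyclotomicExponent p) ((w : ℤ_[p]ˣ) : ℤ_[p]) *
              (cyclotomicGenerator p : ZMod (p ^ ((n) + cyclotomicExponent p))) ^ s.val).val : ℚ) /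
          (p : ℚ) ^ ((n) + cyclotomicExponent p))) * (X + 1) ^ s.val) = T := by
    rw [hξ, hθn, Finset.mul_sum]
    refine Finset.sum_congr rfl fun w _ ↦ ?_
    rw [Finset.sum_mul]
    refine Finset.sum_congr rfl fun k _ ↦ ?_
    rw [Finset.mul_sum]
    refine Finset.sum_congr rfl fun t _ ↦ ?_
    ring
  -- `π(θ_{n+2}) = -T`
  have hLHS : π (∑ w : rootsOfUnity (torsionOrder p) ℤ_[p], ∑ s : ZMod (p ^ (n + 2)),
        C (φ (((PadicInt.toZModPow ((n + 2) + cyclotomicExponent p) ((w : ℤ_[p]ˣ) : ℤ_[p]) *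
              (cyclotomicGenerator p : ZMod (p ^ ((n + 2) + cyclotomicExponent p))) ^ s.val).val : ℚ) /
          (p : ℚ) ^ ((n + 2) + cyclotomicExponent p))) * (X + 1) ^ s.val) = -T := by
    rw [map_thetaSum_eq φ π (n + 2), ← hu]
    -- Step 1: `k = t + p^{n+1} j`, the `j`-sum is an orbit sum
    have h1 : ∀ w : rootsOfUnity (torsionOrder p) ℤ_[p],
        ∑ k ∈ Finset.range (p ^ (n + 2)),
          π (C (φ
            (((PadicInt.toZModPow (n + 2 + (cyclotomicExponent p)) ((w : ℤ_[p]ˣ) : ℤ_[p]) *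
                (cyclotomicGenerator p : ZMod (p ^ (n + 2 + (cyclotomicExponent p)))) ^ k).val : ℚ) /
              (p : ℚ) ^ (n + 2 + (cyclotomicExponent p))))) * u ^ k =
        -∑ t ∈ Finset.range (p ^ (n + 1)),
          π (C (φ
            (((PadicInt.toZModPow (n + 1 + (cyclotomicExponent p)) ((w : ℤ_[p]ˣ) : ℤ_[p]) *
                (cyclotomicGenerator p : ZMod (p ^ (n + 1 + (cyclotomicExponent p)))) ^ t).val : ℚ) /
              (p : ℚ) ^ (n + (cyclotomicExponent p))))) * u ^ t := by
      intro w
      rw [show p ^ (n + 2) = p * p ^ (n + 1) by ring, sum_range_mul_eq_sum_sum', Finset.sum_comm,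
        ← Finset.sum_neg_distrib]
      refine Finset.sum_congr rfl fun t _ ↦ ?_
      simp_rw [hupow t]
      rw [← Finset.sum_mul, ← map_sum, ← map_sum, ← neg_mul, ← map_neg, ← C_neg]
      congr 3
      -- the orbit sum
      set b₀ : ZMod (p ^ (n + 2 + (cyclotomicExponent p))) := PadicInt.toZModPow (n + 2 + (cyclotomicExponent p)) ((w : ℤ_[p]ˣ) : ℤ_[p]) *
        (cyclotomicGenerator p : ZMod (p ^ (n + 2 + (cyclotomicExponent p)))) ^ t with hb₀
      have hb₀u : IsUnit b₀ :=
        ((Units.isUnit _).map _).mul ((isUnit_cyclotomicGenerator_cast p _).pow _)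
      have horb := sum_range_orbit_eq_neg_of_heckeNull φ hH hBI hdvdBI hb₀u hδord hδ1
      have hcast : ZMod.castHom hdvdBI (ZMod (p ^ (n + 1 + (cyclotomicExponent p)))) b₀ =
          PadicInt.toZModPow (n + 1 + (cyclotomicExponent p)) ((w : ℤ_[p]ˣ) : ℤ_[p]) *
            (cyclotomicGenerator p : ZMod (p ^ (n + 1 + (cyclotomicExponent p)))) ^ t := by
        rw [hb₀, map_mul, map_pow, map_natCast, ZMod.castHom_apply,
          PadicInt.cast_toZModPow _ _ (by omega)]
      rw [hcast, hpdiv] at horb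
      rw [← horb]
      refine Finset.sum_congr rfl fun j _ ↦ ?_
      rw [hb₀, pow_add (cyclotomicGenerator p : ZMod (p ^ (n + 2 + (cyclotomicExponent p)))) t (p ^ (n + 1) * j),
        pow_mul (cyclotomicGenerator p : ZMod (p ^ (n + 2 + (cyclotomicExponent p)))) (p ^ (n + 1)) j, mul_assoc]
    -- Step 2: `[p · x/p^{n+1+e₀}]⁺ = [(x mod p^{n+e₀})/p^{n+e₀}]⁺` and `t = t' + p^n k`
    have h2 : ∀ w : rootsOfUnity (torsionOrder p) ℤ_[p],
        ∑ t ∈ Finset.range (p ^ (n + 1)),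
          π (C (φ
            (((PadicInt.toZModPow (n + 1 + (cyclotomicExponent p)) ((w : ℤ_[p]ˣ) : ℤ_[p]) *
                (cyclotomicGenerator p : ZMod (p ^ (n + 1 + (cyclotomicExponent p)))) ^ t).val : ℚ) /
              (p : ℚ) ^ (n + (cyclotomicExponent p))))) * u ^ t =
        ∑ k ∈ Finset.range p, ∑ t ∈ Finset.range (p ^ n),
          π (C (A w t)) * (u ^ t * (u ^ p ^ n) ^ k) := by
      intro w
      rw [show p ^ (n + 1) = p * p ^ n by ring, sum_range_mul_eq_sum_sum']
      refine Finset.sum_congr rfl fun k _ ↦ ?_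
      refine Finset.sum_congr rfl fun t _ ↦ ?_
      have hx : ∀ x : ZMod (p ^ (n + 1 + (cyclotomicExponent p))),
          φ ((x.val : ℚ) / (p : ℚ) ^ (n + (cyclotomicExponent p))) =
            φ (((ZMod.castHom hdvdIS (ZMod (p ^ (n + (cyclotomicExponent p)))) x).val : ℚ) /
              (p : ℚ) ^ (n + (cyclotomicExponent p))) := by
        intro x
        rw [← apply_mul_div_pow_eq_of_periodic φ hP hIS hdvdIS x, hpdiv]
      rw [hx, map_mul, map_pow, map_natCast, ZMod.castHom_apply,
        PadicInt.cast_toZModPow _ _ (by omega),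
        pow_add (cyclotomicGenerator p : ZMod (p ^ (n + (cyclotomicExponent p)))) t (p ^ n * k),
        pow_mul (cyclotomicGenerator p : ZMod (p ^ (n + (cyclotomicExponent p)))) (p ^ n) k, hγS, one_pow, mul_one,
        pow_add u t (p ^ n * k), pow_mul u (p ^ n) k]
    simp_rw [h1, h2]
    rw [hT, ← Finset.sum_neg_distrib]
  rw [map_add, map_mul, hLHS, hRHS, neg_add_cancel]

end ThreeTerm

end Summit.BirchSwinnertonDyer.BirchSwinnertonDyer.Theorems.ResidualThetaLayer

end
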